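import Mathlib.Analysis.Complex.ExponentialBounds
import Literature.Computability.Cryptography.LWEHardness
import HarnessLib

/-!
# Classical hardness of LWE with polynomial modulus (BLPRS 2013): the architecture of the proof of `blprs_gapSVP_sqrt_dim_to_lwe_classical`

Topic `Computability/Cryptography` (family `pqc`). Companion of `LWEHardness.lean` for the named fact
`Literature.Computability.Cryptography.blprs_gapSVP_sqrt_dim_to_lwe_classical` (**pqc.S21**; Brakerski,
Langlois, Peikert, Regev, Stehlé, *Classical hardness of learning with errors*, STOC 2013, Thm. 1.1), in
the style of `PeikertReduction.lean` (pqc.S20) and `RegevReduction.lean` (pqc.S19). Everything here is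
PROVED and no named fact is introduced (D-0026): the printed components of the proof are explicit
hypotheses of the assembly theorem, one of them being the tree's own pqc.S22 (`regev_search_to_decision`).

The authors' architecture (arXiv version, §4, the paragraph after Thm. 4.1, p. 13): *"By combining
Theorem 4.1 with the reduction in Corollary 3.2 (and noting that `{0,1}ⁿ` is `(√n, 0)`-bounded), we can
replace the `binLWE` problem above with `binLWE_{n,m,q',β}` for any `q' ≥ 1` and `ξ > 0` where
`β = (10nα² + (4n/(πq'²)) ln(2n(1+1/ξ)))^{1/2}`, while decreasing the advantage by `14ξm`. Recalling
that LWE of dimension `k = √n` and modulus `q = 2^{k/2}` is known to be classically as hard as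
`√n`-dimensional lattice problems (Theorems 2.16 and 2.17), this gives a formal statement of
Theorem 1.1."* — together with *"(Strictly speaking, one also needs to apply Lemma 2.15 to replace
the 'unknown noise' variant of LWE given by Corollary 3.2 with the fixed noise variant.)"* (ibid.) and
the random self-reduction of Def. 2.11 (`LWE(D) ≤ LWE(U)` for any secret distribution `D`, p. 8).
So, reading the reductions bottom-up from the search-`LWE_{n,q,Ψ̄_α}` oracle `O` of pqc.S21:

  `O` ─(pqc.S22, search ⇒ decision, `h₄ : regev_search_to_decision q`)→ a distinguisher for
  `LWE_{n,q,Ψ̄_α}` with inverse-polynomial advantage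
  ─(**§3–§4: Thm. 4.1 + Cor. 3.2 + Lemma 2.15**, hypothesis `h₃`)→ a distinguisher for
  `LWE_{d,Q,Ψ̄_{α₂}}`, `d = ⌊√n⌋`, `Q = 2^{⌊d/2⌋+2}`
  ─(**Thm. 2.17** = Micciancio–Peikert 2012, search-to-decision for a power-of-two modulus,
  hypothesis `h₂`)→ a solver for search-`LWE_{d,Q,Ψ̄_{α₁}}`, `α₂ = α₁ · ω(log d)`
  ─(**Thm. 2.16, classical clause** = Peikert 2009, Thm. 3.1 with `Q ≥ 2^{d/2}`, hypothesis `h₁`)→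
  a decider for `GapSVP` in dimension `d = ⌊√n⌋` with factor `Õ(d/α₁) = poly(n)`.

## Results

* Glue (definitions with bodies, grouping namespace `BLPRS2013`): the derived parameter sequences,
  all indexed by the LWE dimension `n` of pqc.S21 — `dim n = ⌊√n⌋` (`d`), `modulus n = 2^{⌊d/2⌋+2}`
  (`Q`, a power of two with `Q ≥ 2^{d/2}`), `rate₂ α n = α(n)/(8d)` (`α₂`), `rate₁ α n = α₂/(⌊log₂ n⌋+1)²`
  (`α₁`), `gapFactorSeq α n = max 1 (4d/α₁)`; the `1ⁿ`-tagged solver/distinguisher presented by an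
  oracle algorithm at the intermediate level `(d, Q)` (`taggedSearchSolver`, `taggedDistinguisher`, the
  input being `boolPair 1ⁿ (encodeLWESamples S)` exactly as the `GapSVP` input of pqc.S21 is
  `boolPair 1ⁿ (code of the instance)`); the interface predicates `SolvesSmallDimSearch` (search
  `LWE_{d,Q,Ψ̄_{α₁}}` with average-case probability `≥ 2/3`), `DistinguishesSmallDim` (decision
  `LWE_{d,Q,Ψ̄_{α₂}}` with advantage `≥ 1/n^c`), `DecidesGapSVPSqrtDim` (the conclusion of pqc.S21 with
  an `n`-indexed factor); and the dimension re-indexing `blockMax g D = max(1, max_{D² ≤ n < (D+1)²} g n)`.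
* **Parameter bookkeeping, PROVED**: `le_blockMax` (`g n ≤ blockMax g ⌊√n⌋`),
  `isPolyBoundedReal_blockMax` (a sequence eventually dominated by a polynomial has a polynomially
  bounded block maximum), `eventually_gapFactorSeq_le` (under the hypotheses of pqc.S21 with `k = 1`,
  `gapFactorSeq α n ≤ poly(n)`), `eventually_two_le` (the hypotheses force `q ≥ 2`, pqc.S22's `hq2`),
  `eventually_threshold_le_gapFactorSeq` (`2d/(α₁√(log d)) ≤ gapFactorSeq`, Peikert's admissible
  factor), `eventually_mul_eval_le_two_pow_half_dim` (`A · p(n) ≤ 2^{⌊d/2⌋}` eventually, for every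
  polynomial `p`: the intermediate modulus is exponential in `d` but the other parameters are
  polynomial in `n < (d+1)²`), and the printed side conditions of the components for the fixed
  formulas: `log_two_modulus`, `two_rpow_half_dim_le_modulus` (`Q` is a power of two, `2^{d/2} ≤ Q`;
  Thms. 2.16/2.17), `eventually_dim_condition` (Thm. 4.1's `n ≥ (k+1) log₂ Q + 2 log₂(1/δ)` with
  `k = d`, `δ = 2^{-⌊n/8⌋}`), `rate₂_eq_rate₁_mul` and `eventually_rates` (`0 < α₁ < α₂ < α < 1`,
  `1/Q < α₁`, `2√d ≤ α₁ Q`, `α₂ = α₁ (⌊log₂ n⌋+1)²`; Thms. 2.16/2.17), `eventually_noise_budget` and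
  `eventually_modSwitch_budget` (`20 n α₂² ≤ α²` and `(8n/π) ln(2n(1+n^c)) ≤ (αq)²`: the two halves of
  Cor. 3.2's `β² = 10nα₂² + (4n/(πq²)) ln(2n(1+1/ξ)) ≤ α²` at quality `ξ = n^{-c}`).
* **Assembly, PROVED**: `blprs_gapSVP_sqrt_dim_to_lwe_classical_of_components h₁ h₂ h₃ h₄ :
  blprs_gapSVP_sqrt_dim_to_lwe_classical q m` with `k = 1` (`αq ≥ √n log n`) and
  `γ = blockMax (gapFactorSeq α)`.

## The four components (machine forms; `h₁`–`h₃` NOT proved here, `h₄` is pqc.S22)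

All machines are G01 oracle algorithms run with random coins (`OracleAlg.randRun`) relative to the SAME
base oracle `O` of pqc.S21, and each component is an *oracle-algorithm transformer* — "for every
probabilistic polynomial-time `R` there is a probabilistic polynomial-time `M` such that for every `O`,
if `R^O` solves the lower problem then `M^O` solves the upper one" — which is how a black-box
reduction calling a randomised subroutine is expressed without a composition theorem for `OracleAlg`
(the convention of `peikert_gapSVPZeta_to_lwe_classical_of_components`). Intermediate problems are
stated with DISCRETISED noise `Ψ̄_φ = discretizedGaussian` on `ℤ_Q` and EXACT rates, in the tree's
vocabulary (`lweSamples`, `distinguishingAdvantage`, `searchSuccessProb`, `encodeLWESamples`); the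
continuous torus samples of the paper live inside the components ("efficient reductions between
problems on real numbers at finite precision", §2 of the paper; Regev 2009, Lemma 4.3 for
continuous-to-discrete, and at level `(d, Q)` the re-continuisation error of a `Ψ̄_φ`-sample is
`O(1/(φQ)) = poly(n) 2^{-d/2}`, negligible, since `α₁ Q ≥ 2^{d/2}/poly(n)`).

* `h₁` — **Thm. 2.16, classical clause** ("Let `n, q ≥ 1` be integers and let `α ∈ (0,1)` be such
  that `αq ≥ 2√n`. … If in addition `q ≥ 2^{n/2}` then there is also a classical reduction" from
  worst-case `n`-dimensional `GapSVP_{Õ(n/α)}` to (search) `LWE_{n,q,α}`; from Peikert 2009, Thm. 3.1,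
  whose admissible factor is `γ ≥ n/(α√(log n))`), at dimension `d = ⌊√n⌋`, modulus `Q`, rate `α₁`:
  for every factor `g` eventually `≥ 2d/(α₁√(log d))` and every probabilistic polynomial-time `R`
  with a polynomially bounded, polynomial-time computable number of samples `m₁`, a probabilistic
  polynomial-time `M` such that `M^O` decides `GapSVP` in dimension `d` with factor `g n` (given `1ⁿ`)
  whenever `R^O` solves search-`LWE_{d,Q,Ψ̄_{α₁}}` (given `1ⁿ`) with average-case probability `≥ 2/3`.
* `h₂` — **Thm. 2.17** ("Let `q` be a power of `2`, and `α` satisfy `1/q < α < 1/ω(√(log n))`. Then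
  there exists an efficient reduction from search `LWE_{n,q,α}` to (decision) `LWE_{n,q,α'}` for
  `α' = α · ω(log n)`"; special case of Micciancio–Peikert 2012), at `(d, Q, α₁, α₂ = α₁(⌊log₂ n⌋+1)²)`:
  every probabilistic polynomial-time distinguisher for `LWE_{d,Q,Ψ̄_{α₂}}` with advantage `≥ 1/n^c`
  on `m₂` samples yields a probabilistic polynomial-time solver for search-`LWE_{d,Q,Ψ̄_{α₁}}`.
* `h₃` — **§3–§4 (Thm. 4.1 with Cor. 3.2 and Lemma 2.15; Def. 2.11)**: every probabilistic
  polynomial-time distinguisher for `LWE_{n,q,Ψ̄_α}` with advantage `≥ 1/n^c` on a polynomially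
  bounded number `m₃` of samples yields a probabilistic polynomial-time distinguisher for
  `LWE_{d,Q,Ψ̄_{α₂}}` with inverse-polynomial advantage (Thm. 4.1 at `k = d`, modulus `Q`, target
  dimension `n ≥ (d+1) log₂ Q + 2 log₂(1/δ)`; Cor. 3.2 from `Q` to `q`; Lemma 2.15 for the unknown
  rate `≤ α`, whose algorithm `B` re-randomises the secret by the shifts `(a, b) ↦ (a, b + ⟨a, t⟩)`, so
  that the AVERAGE-case advantage `1/n^c` of the given distinguisher is what its Chernoff estimates
  detect; the standard random self-reduction from `{0,1}`-secrets to uniform secrets, Def. 2.11; the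
  sample count `m₃` of the given distinguisher is only known to be polynomially bounded, and the
  reduction calibrates it by the same Chernoff estimation against self-generated samples).
* `h₄` — **pqc.S22** `regev_search_to_decision q` (Regev 2009, §4, search ⇒ decision): the tree's
  named fact, consumed as is.

## Faithfulness notes

* The informal Thm. 1.1 has no numbered formal counterpart in the paper; the chain above is the
  paper's own "formal statement of Theorem 1.1" (p. 13). pqc.S21's hypothesis is a SEARCH oracle for
  the discretised `Ψ̄_α`, the paper's problems are DECISION problems with continuous noise: the bridge
  is pqc.S22 (search ⇒ decision) at the bottom and Thm. 2.17 (decision ⇒ search) below Peikert's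
  search-based Thm. 2.16 at the top, exactly the two conversions the paper names.
* `k = 1` in pqc.S21's `αq ≥ √n (log n)^k`: the chain needs `βq ≥ √((8n/π) ln(2n(1+1/ξ)))` with
  `ξ = 1/poly(n)` (advantage loss `14ξm`), i.e. `αq ≥ C√(n log n)`, and `√n log n / √(n log n) → ∞`.
* `Q = 2^{⌊d/2⌋+2}` rather than the paper's "`q = 2^{k/2}` (assume `k` is even)": any power of two with
  `Q ≥ 2^{d/2}` serves Thms. 2.16/2.17, and Thm. 4.1's dimension condition
  `n ≥ (d+1) log₂ Q + 2 log₂(1/δ)` holds eventually with `δ = 2^{-⌊n/8⌋}` (`eventually_dim_condition`);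
  the two extra bits leave room for the LLL preprocessing by which Peikert's `GapSVP_{ζ,γ}`-reduction
  serves plain `GapSVP_γ` when `q ≥ 2^{n/2}` (Peikert 2009, §3).
* The `GapSVP` dimension of pqc.S21 is `⌊√n⌋`, so several `n` share one dimension `D`; the factor of
  the conclusion is `γ(D) = max(1, max_{D² ≤ n < (D+1)²} g(n))`, and a `GapSVP_γ` NO instance of
  dimension `⌊√n⌋` is a NO instance for the factor `g(n)` used at `n` (`GapSVP.no` only shrinks as the
  factor grows; YES instances do not depend on it).
* Average case: all success probabilities/advantages are over a uniform secret, as in pqc.S21/S22 and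
  in the paper's Def. 2.11; worst-case-in-`s` intermediate forms stay inside the components.

## References

* Z. Brakerski, A. Langlois, C. Peikert, O. Regev, D. Stehlé, *Classical hardness of learning with
  errors*, STOC 2013, 575–584; arXiv:1306.0281: Thm. 1.1, Def. 2.11, Def. 2.14, Lemma 2.15, Thm. 2.16,
  Thm. 2.17, Thm. 3.1, Cor. 3.2, Thm. 4.1 and the paragraph following it (p. 13) [BrakerskiEtAl2013]
  (read: `lit read arxiv:1306.0281`, chunks 8–10, 13).
* C. Peikert, *Public-key cryptosystems from the worst-case shortest vector problem*, STOC 2009, §3,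
  Thm. 3.1 [Peikert2009].
* D. Micciancio, C. Peikert, *Trapdoors for lattices: simpler, tighter, faster, smaller*, EUROCRYPT 2012,
  LNCS 7237, 700–718 (search-to-decision for prime-power moduli) [MicciancioPeikert2012].
* O. Regev, *On lattices, learning with errors, random linear codes, and cryptography*, J. ACM 56 (2009),
  Lemma 3.6, Lemma 3.7, §4 (Lemmas 4.1–4.3) [RegevLWE2009].
-/

noncomputable section

open Filter Asymptotics Computability Literature.Computability.Complexity
  Literature.Computability.Cryptography.LWE Literature.Algebra.EuclideanLattices
  Literature.Computability.Cryptography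
open scoped ENNReal

namespace Literature.Computability.Cryptography

namespace BLPRS2013

/-! ### The derived parameters (all indexed by the LWE dimension `n` of pqc.S21) -/

/-- The lattice dimension `d = ⌊√n⌋` of pqc.S21 (the `k = √n` of the paper, p. 13).
[cite: BrakerskiEtAl2013, Thm. 1.1 and p. 13] -/
def dim (n : ℕ) : ℕ := Nat.sqrt n

/-- The intermediate modulus `Q = 2^{⌊d/2⌋+2}`: a power of two (Thm. 2.17) with `Q ≥ 2^{d/2}`
(Thm. 2.16, classical clause); the paper's "`q = 2^{k/2}`", up to two bits of slack.
[cite: BrakerskiEtAl2013, Thm. 2.16, Thm. 2.17 and p. 13] -/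
def modulus (n : ℕ) : ℕ := 2 ^ (dim n / 2 + 2)

/-- `Q ≠ 0` (so that `ZMod Q` is a finite ring and `discretizedGaussian Q` is defined). [folklore] -/
instance modulus.instNeZero (n : ℕ) : NeZero (modulus n) := ⟨pow_ne_zero _ two_ne_zero⟩

/-- The noise rate `α₂ = α/(8d)` of the intermediate decision problem `LWE_{d,Q,α₂}` (the `α` of
Thm. 4.1 at `k = d`): then `binLWE_{n,Q,≤√(10n)α₂}` and Cor. 3.2's `β² = 10nα₂² + (4n/(πq²)) ln(2n(1+1/ξ))`
stays `≤ α²` (`eventually_noise_budget` and `αq ≥ √n log n`). Rational in `α(n)`.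
[cite: BrakerskiEtAl2013, Thm. 4.1 and Cor. 3.2 (p. 13)] -/
def rate₂ (α : ℕ → ℝ) (n : ℕ) : ℝ := α n / (8 * dim n)

/-- The noise rate `α₁ = α₂/(⌊log₂ n⌋+1)²` of the intermediate search problem `LWE_{d,Q,α₁}`, so that
`α₂ = α₁ · ω(log d)` (Thm. 2.17) and `α₁ ∈ (1/Q, 1)`, `α₁ Q ≥ 2√d` (Thm. 2.16). Rational in `α(n)`.
[cite: BrakerskiEtAl2013, Thm. 2.16 and Thm. 2.17] -/
def rate₁ (α : ℕ → ℝ) (n : ℕ) : ℝ := rate₂ α n / ((Nat.log 2 n + 1 : ℕ) : ℝ) ^ 2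

/-- The `GapSVP` factor used at LWE dimension `n`: `g(n) = max(1, 4d/α₁)`, above Peikert's admissible
`2d/(α₁√(log d))` once `d ≥ 3` (`eventually_threshold_le_gapFactorSeq`); `Õ(d/α₁)` as in Thm. 2.16.
[cite: BrakerskiEtAl2013, Thm. 2.16; Peikert2009, Thm. 3.1] -/
def gapFactorSeq (α : ℕ → ℝ) (n : ℕ) : ℝ := max 1 (4 * dim n / rate₁ α n)

/-- `1 ≤ g(n)`. [folklore] -/
theorem one_le_gapFactorSeq (α : ℕ → ℝ) (n : ℕ) : 1 ≤ gapFactorSeq α n := le_max_left _ _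

/-! ### Re-indexing a factor by the lattice dimension -/

/-- The block of LWE dimensions `n` with `⌊√n⌋ = D`, i.e. `D² ≤ n < (D+1)²`. [folklore] -/
def block (D : ℕ) : Finset ℕ := Finset.Ico (D ^ 2) ((D + 1) ^ 2)

/-- The block of `D` is nonempty (it contains `D²`). [folklore] -/
theorem block_nonempty (D : ℕ) : (block D).Nonempty :=
  ⟨D ^ 2, Finset.mem_Ico.2 ⟨le_rfl, Nat.pow_lt_pow_left (Nat.lt_succ_self D) two_ne_zero⟩⟩

/-- `n` lies in the block of `⌊√n⌋`. [folklore] -/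
theorem mem_block_sqrt (n : ℕ) : n ∈ block (Nat.sqrt n) := by
  rw [block, Finset.mem_Ico]
  exact ⟨Nat.sqrt_le' n, Nat.lt_succ_sqrt' n⟩

/-- `blockMax g D = max(1, max_{D² ≤ n < (D+1)²} g(n))`: the factor, as a function of the lattice
dimension `D`, that dominates the factor `g(n)` used at every LWE dimension `n` with `⌊√n⌋ = D`
("every dimension `d` is reached at `n = d²`", docstring of pqc.S21). [folklore] -/
def blockMax (g : ℕ → ℝ) (D : ℕ) : ℝ := max 1 ((block D).sup' (block_nonempty D) g)

/-- `1 ≤ blockMax g D`. [folklore] -/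
theorem one_le_blockMax (g : ℕ → ℝ) (D : ℕ) : 1 ≤ blockMax g D := le_max_left _ _

/-- `g(n) ≤ blockMax g ⌊√n⌋`. [folklore] -/
theorem le_blockMax (g : ℕ → ℝ) (n : ℕ) : g n ≤ blockMax g (Nat.sqrt n) :=
  le_trans (Finset.le_sup' g (mem_block_sqrt n)) (le_max_right _ _)

/-- A real sequence eventually dominated by a polynomial has a polynomially bounded block maximum
(the finitely many exceptional `n` are absorbed in a constant, and `n < (D+1)²` on the block of `D`).
[folklore] -/
theorem isPolyBoundedReal_blockMax {g : ℕ → ℝ} {p : Polynomial ℕ}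
    (hg : ∀ᶠ n : ℕ in atTop, g n ≤ ((p.eval n : ℕ) : ℝ)) : IsPolyBoundedReal (blockMax g) := by
  obtain ⟨N, hN⟩ := eventually_atTop.1 hg
  obtain ⟨c, k, hck⟩ := exists_eval_le_mul_pow_add p
  -- a constant absorbing the exceptional `n < N`
  set B : ℕ := ⌈∑ i ∈ Finset.range N, |g i|⌉₊ with hBdef
  have hB : ∀ n, n < N → g n ≤ B := fun n hn => by
    have h2 : |g n| ≤ ∑ i ∈ Finset.range N, |g i| :=
      Finset.single_le_sum (f := fun i => |g i|) (fun i _ => abs_nonneg _) (Finset.mem_range.2 hn)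
    exact (le_abs_self _).trans (h2.trans (Nat.le_ceil _))
  have hall : ∀ n : ℕ, g n ≤ (B : ℝ) + (c * (n : ℝ) ^ k + c) := fun n => by
    have hc0 : (0 : ℝ) ≤ c * (n : ℝ) ^ k + c := by positivity
    have hB0 : (0 : ℝ) ≤ B := by positivity
    rcases lt_or_ge n N with hn | hn
    · linarith [hB n hn]
    · have h2 : ((p.eval n : ℕ) : ℝ) ≤ c * (n : ℝ) ^ k + c := by exact_mod_cast hck n
      linarith [hN n hn]
  refine ⟨Polynomial.C (B + c + 1) + Polynomial.C c * (Polynomial.X + 1) ^ (2 * k), fun D => ?_⟩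
  simp only [Polynomial.eval_add, Polynomial.eval_mul, Polynomial.eval_C, Polynomial.eval_pow,
    Polynomial.eval_X, Polynomial.eval_one, Nat.cast_add, Nat.cast_mul, Nat.cast_pow, Nat.cast_one]
  have hc0 : (0 : ℝ) ≤ c := by positivity
  have hpow0 : (0 : ℝ) ≤ c * ((D : ℝ) + 1) ^ (2 * k) := by positivity
  refine max_le ?_ (Finset.sup'_le _ _ fun n hn => ?_)
  · have hB0 : (0 : ℝ) ≤ B := by positivity
    linarith
  · have hn' : n < (D + 1) ^ 2 := (Finset.mem_Ico.1 hn).2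
    have hnk : (n : ℝ) ^ k ≤ ((D : ℝ) + 1) ^ (2 * k) := by
      rw [pow_mul]
      have : (n : ℝ) ≤ ((D : ℝ) + 1) ^ 2 := by exact_mod_cast hn'.le
      exact pow_le_pow_left₀ (by positivity) this k
    calc g n ≤ (B : ℝ) + (c * (n : ℝ) ^ k + c) := hall n
      _ ≤ (B : ℝ) + c + 1 + c * ((D : ℝ) + 1) ^ (2 * k) := by
          nlinarith [mul_le_mul_of_nonneg_left hnk hc0]

/-! ### The intermediate problems at level `(d, Q)` and the final `GapSVP` decider (interfaces) -/

/-- LOCAL GLUE. The search-`LWE` solver in dimension `d` over `ℤ_Q` on `m` samples presented by the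
randomised oracle algorithm `R` (string output) with oracle `O` at LWE dimension `n` of pqc.S21: the
input is the tagged code `boolPair 1ⁿ (encodeLWESamples S)` (the tag `1ⁿ` fixes the ambient
parameters `q(n), α(n), …`, exactly as the `GapSVP` instances of pqc.S21 are tagged), the output word
is decoded as a secret (`decodeSecret`, a timeout decodes to the junk secret `0`).
[cite: BrakerskiEtAl2013, Def. 2.11 (search variant) and p. 13] -/
def taggedSearchSolver (R : OracleAlg (List Bool)) (O : Oracle) (coins fuel : Polynomial ℕ)
    (n d Q m : ℕ) : Solver (Fin d) (ZMod Q) m :=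
  fun S => (R.randRun O coins fuel (boolPair (unaryEncodeNat n) (encodeLWESamples S))).map
    fun o => decodeSecret d Q (o.getD [])

/-- LOCAL GLUE. The decision-`LWE` distinguisher in dimension `d` over `ℤ_Q` on `m` samples presented
by the randomised oracle algorithm `R` (Boolean output) with oracle `O` at LWE dimension `n`: input
`boolPair 1ⁿ (encodeLWESamples S)`, a timeout counts as rejection.
[cite: BrakerskiEtAl2013, Def. 2.11 and p. 13] -/
def taggedDistinguisher (R : OracleAlg Bool) (O : Oracle) (coins fuel : Polynomial ℕ)
    (n d Q m : ℕ) : Distinguisher (Fin d) (ZMod Q) m :=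
  fun S => (R.randRun O coins fuel (boolPair (unaryEncodeNat n) (encodeLWESamples S))).map
    fun o => o.getD false

/-- LOCAL GLUE (interface `I₁`). `R^O` solves the intermediate SEARCH problem
`LWE_{d,Q,Ψ̄_{α₁}}` of the chain (Thm. 2.16's target / Thm. 2.17's source) from `m₁ n` samples with
average-case success probability `≥ 2/3`, for all large `n` (`d = dim n`, `Q = modulus n`,
`α₁ = rate₁ α n`; discretised noise `Ψ̄` as in pqc.S21, cf. Regev 2009, Lemma 4.3).
[cite: BrakerskiEtAl2013, Thm. 2.16 and Thm. 2.17] -/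
def SolvesSmallDimSearch (α : ℕ → ℝ) (R : OracleAlg (List Bool)) (O : Oracle)
    (coins fuel : Polynomial ℕ) (m₁ : ℕ → ℕ) : Prop :=
  ∀ᶠ n : ℕ in atTop, ENNReal.ofReal (2 / 3) ≤
    searchSuccessProb (discretizedGaussian (modulus n) (rate₁ α n)) (m₁ n)
      (taggedSearchSolver R O coins fuel n (dim n) (modulus n) (m₁ n))

/-- LOCAL GLUE (interface `I₂`). `R^O` distinguishes the intermediate DECISION problem
`LWE_{d,Q,Ψ̄_{α₂}}` of the chain (Thm. 2.17's target / Thm. 4.1's source, `α₂ = rate₂ α n`) from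
uniform on `m₂ n` samples with (average-case) advantage `≥ 1/n^c`, for all large `n`.
[cite: BrakerskiEtAl2013, Def. 2.11, Thm. 2.17 and Thm. 4.1] -/
def DistinguishesSmallDim (α : ℕ → ℝ) (R : OracleAlg Bool) (O : Oracle)
    (coins fuel : Polynomial ℕ) (m₂ : ℕ → ℕ) (c : ℕ) : Prop :=
  ∀ᶠ n : ℕ in atTop, 1 / (n : ℝ) ^ c ≤
    distinguishingAdvantage (discretizedGaussian (modulus n) (rate₂ α n)) (m₂ n)
      (taggedDistinguisher R O coins fuel n (dim n) (modulus n) (m₂ n))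

/-- LOCAL GLUE (interface `I₀`). `M^O` decides `GapSVP` in dimension `d = ⌊√n⌋` with the `n`-indexed
factor `g n`, in the format of the conclusion of pqc.S21: given `boolPair 1ⁿ (code of (B, t))` with
`B` of dimension `⌊√n⌋`, for all large `n`, it answers `some true` with probability `≥ 2/3` if
`λ₁(L(B)) ≤ t` and `some false` with probability `≥ 2/3` if `λ₁(L(B)) > g(n) · t` (the sets
`GapSVP.yes/no` at the constant factor function `fun _ => g n`).
[cite: BrakerskiEtAl2013, Thm. 1.1 and Thm. 2.16] -/
def DecidesGapSVPSqrtDim (g : ℕ → ℝ) (M : OracleAlg Bool) (O : Oracle)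
    (coins fuel : Polynomial ℕ) : Prop :=
  ∀ᶠ n : ℕ in atTop, ∀ p : GapSVPInstance, p.1.n = dim n →
    (p ∈ GapSVP.yes (fun _ => g n) →
      2 / 3 ≤ M.randRun O coins fuel (boolPair (unaryEncodeNat n) p.encode) (some true)) ∧
    (p ∈ GapSVP.no (fun _ => g n) →
      2 / 3 ≤ M.randRun O coins fuel (boolPair (unaryEncodeNat n) p.encode) (some false))

/-- Re-indexing the factor by the dimension: a decider for the `n`-indexed factor `g` decides
`GapSVP_γ` for `γ = blockMax g` on instances of dimension `⌊√n⌋` (YES instances do not depend on the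
factor; a NO instance for `γ(⌊√n⌋) ≥ g(n)` is a NO instance for `g(n)`). [folklore] -/
theorem DecidesGapSVPSqrtDim.blockMax {g : ℕ → ℝ} {M : OracleAlg Bool} {O : Oracle}
    {coins fuel : Polynomial ℕ} (h : DecidesGapSVPSqrtDim g M O coins fuel) :
    ∀ᶠ n : ℕ in atTop, ∀ p : GapSVPInstance, p.1.n = Nat.sqrt n →
      (p ∈ GapSVP.yes (blockMax g) →
        2 / 3 ≤ M.randRun O coins fuel (boolPair (unaryEncodeNat n) p.encode) (some true)) ∧
      (p ∈ GapSVP.no (blockMax g) →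
        2 / 3 ≤ M.randRun O coins fuel (boolPair (unaryEncodeNat n) p.encode) (some false)) := by
  filter_upwards [h] with n hn p hp
  refine ⟨fun hyes => (hn p hp).1 hyes, fun hno => (hn p hp).2 ?_⟩
  obtain ⟨h1, h2, h3⟩ := hno
  refine ⟨h1, h2, lt_of_le_of_lt ?_ h3⟩
  rw [hp]
  exact mul_le_mul_of_nonneg_right (le_blockMax g n) (by exact_mod_cast h2.le)

/-! ### Parameter bookkeeping under the hypotheses of pqc.S21 (`k = 1`) -/

section Parameters

variable {q : ℕ → ℕ} {α : ℕ → ℝ}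

/-- `1 ≤ √n · log n` for `n ≥ 3` (`e < 3`). [folklore] -/
theorem one_le_sqrt_mul_log {n : ℕ} (hn : 3 ≤ n) : 1 ≤ Real.sqrt n * Real.log n := by
  have hn' : (3 : ℝ) ≤ n := by exact_mod_cast hn
  have h1 : 1 ≤ Real.sqrt n := by
    rw [show (1 : ℝ) = Real.sqrt 1 by simp]
    exact Real.sqrt_le_sqrt (by linarith)
  have h2 : 1 ≤ Real.log n := by
    rw [Real.le_log_iff_exp_le (by linarith)]
    have := Real.exp_one_lt_d9
    linarith
  nlinarith

/-- Under `αq ≥ √n log n` (and `0 < α`), eventually `1 ≤ α(n) q(n)`, hence `1/α(n) ≤ q(n)`. [folklore] -/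
theorem eventually_inv_rate_le
    (hα : ∀ᶠ n : ℕ in atTop, 0 < α n ∧ α n < 1 ∧ Real.sqrt n * Real.log n ≤ α n * q n) :
    ∀ᶠ n : ℕ in atTop, 0 < α n ∧ α n < 1 ∧ 1 ≤ α n * q n ∧ 1 / α n ≤ q n := by
  filter_upwards [hα, eventually_ge_atTop 3] with n hn h3
  have h1 : 1 ≤ α n * q n := (one_le_sqrt_mul_log h3).trans hn.2.2
  refine ⟨hn.1, hn.2.1, h1, ?_⟩
  rw [div_le_iff₀ hn.1, mul_comm]
  exact h1

/-- The hypotheses of pqc.S21 force `q(n) ≥ 2` eventually (`q ≥ αq ≥ √n log n ≥ 2` for `n ≥ 4`);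
this is the hypothesis `hq2` of pqc.S22 `regev_search_to_decision`. [cite: RegevLWE2009, §4] -/
theorem eventually_two_le
    (hα : ∀ᶠ n : ℕ in atTop, 0 < α n ∧ α n < 1 ∧ Real.sqrt n * Real.log n ≤ α n * q n) :
    ∀ᶠ n : ℕ in atTop, 2 ≤ q n := by
  filter_upwards [hα, eventually_ge_atTop 4] with n hn h4
  have hn' : (4 : ℝ) ≤ n := by exact_mod_cast h4
  have hs : 2 ≤ Real.sqrt n := by
    rw [show (2 : ℝ) = Real.sqrt 4 by
      rw [show (4 : ℝ) = 2 ^ 2 by norm_num, Real.sqrt_sq (by norm_num)]]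
    exact Real.sqrt_le_sqrt hn'
  have hl : 1 ≤ Real.log n := by
    rw [Real.le_log_iff_exp_le (by linarith)]
    have := Real.exp_one_lt_d9
    linarith
  have h2 : (2 : ℝ) ≤ α n * q n := le_trans (by nlinarith) hn.2.2
  have hq0 : (0 : ℝ) ≤ q n := by positivity
  have h3 : α n * q n ≤ q n := by nlinarith [hn.2.1]
  exact_mod_cast h2.trans h3

/-- Closed form of `α₁`: `rate₁ α n = α(n) / (8 d (⌊log₂ n⌋+1)²)`. [folklore] -/
theorem rate₁_eq (α : ℕ → ℝ) (n : ℕ) :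
    rate₁ α n = α n / (8 * dim n * ((Nat.log 2 n + 1 : ℕ) : ℝ) ^ 2) := by
  rw [rate₁, rate₂, div_div]

/-- Eventually `0 < α₁(n)` (needs `α(n) > 0` and `d ≥ 1`). [folklore] -/
theorem eventually_rate₁_pos (hα : ∀ᶠ n : ℕ in atTop, 0 < α n) :
    ∀ᶠ n : ℕ in atTop, 0 < rate₁ α n := by
  filter_upwards [hα, eventually_ge_atTop 1] with n hn h1
  have hd : 0 < dim n := Nat.sqrt_pos.2 h1
  rw [rate₁_eq]
  positivity

/-- **`γ` is polynomial.** Under the hypotheses of pqc.S21 with `k = 1` (`q` polynomially bounded,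
`α(n) ∈ (0,1)`, `αq ≥ √n log n`), the factor used at dimension `n` is eventually dominated by a
polynomial: `g(n) = max(1, 32 d² (⌊log₂ n⌋+1)²/α(n)) ≤ 1 + 32 n (n+1)² q(n)` (`1/α ≤ q`).
[cite: BrakerskiEtAl2013, Thm. 1.1 (polynomial approximation factor)] -/
theorem eventually_gapFactorSeq_le (hq : IsPolyBounded q)
    (hα : ∀ᶠ n : ℕ in atTop, 0 < α n ∧ α n < 1 ∧ Real.sqrt n * Real.log n ≤ α n * q n) :
    ∃ p : Polynomial ℕ, ∀ᶠ n : ℕ in atTop, gapFactorSeq α n ≤ ((p.eval n : ℕ) : ℝ) := by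
  obtain ⟨pq, hpq⟩ := hq
  refine ⟨1 + Polynomial.C 32 * Polynomial.X * (Polynomial.X + 1) ^ 2 * pq, ?_⟩
  filter_upwards [eventually_inv_rate_le hα, eventually_ge_atTop 1] with n hn h1
  obtain ⟨hα0, -, h1αq, -⟩ := hn
  have hd : 0 < dim n := Nat.sqrt_pos.2 h1
  set L : ℝ := ((Nat.log 2 n + 1 : ℕ) : ℝ) with hL
  have hL1 : 1 ≤ L := by rw [hL]; exact_mod_cast Nat.succ_le_succ (Nat.zero_le _)
  have hd' : (0 : ℝ) < dim n := by exact_mod_cast hd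
  -- the closed form of `4 d / α₁`
  have hmain : 4 * (dim n : ℝ) / rate₁ α n = 32 * (dim n : ℝ) ^ 2 * L ^ 2 / α n := by
    rw [rate₁_eq, ← hL]
    field_simp
    ring
  -- `1/α ≤ q`, so `32 d² L² / α ≤ 32 d² L² q`
  have hle : 32 * (dim n : ℝ) ^ 2 * L ^ 2 / α n ≤ 32 * (dim n : ℝ) ^ 2 * L ^ 2 * q n := by
    rw [div_le_iff₀ hα0]
    have h0 : (0 : ℝ) ≤ 32 * (dim n : ℝ) ^ 2 * L ^ 2 := by positivity
    nlinarith
  -- crude polynomial bounds `d² ≤ n`, `L ≤ n + 1`, `q ≤ pq`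
  have hd2 : ((dim n : ℝ)) ^ 2 ≤ n := by
    rw [dim]
    exact_mod_cast Nat.sqrt_le' n
  have hLn : L ≤ (n : ℝ) + 1 := by
    rw [hL]
    have : Nat.log 2 n ≤ n := Nat.log_le_self 2 n
    exact_mod_cast Nat.succ_le_succ this
  have hqp : (q n : ℝ) ≤ ((pq.eval n : ℕ) : ℝ) := by exact_mod_cast hpq n
  simp only [Polynomial.eval_add, Polynomial.eval_one, Polynomial.eval_mul, Polynomial.eval_C,
    Polynomial.eval_X, Polynomial.eval_pow, Nat.cast_add, Nat.cast_one, Nat.cast_mul, Nat.cast_pow,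
    Nat.cast_ofNat]
  refine max_le ?_ ?_
  · have : (0 : ℝ) ≤ 32 * (n : ℝ) * ((n : ℝ) + 1) ^ 2 * ((pq.eval n : ℕ) : ℝ) := by positivity
    linarith
  · rw [hmain]
    refine hle.trans ?_
    have hq0 : (0 : ℝ) ≤ q n := by positivity
    have hL0 : (0 : ℝ) ≤ L := by linarith
    calc 32 * (dim n : ℝ) ^ 2 * L ^ 2 * q n ≤ 32 * (n : ℝ) * ((n : ℝ) + 1) ^ 2 * q n := by
          gcongr
      _ ≤ 32 * (n : ℝ) * ((n : ℝ) + 1) ^ 2 * ((pq.eval n : ℕ) : ℝ) := by gcongr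
      _ ≤ 1 + 32 * (n : ℝ) * ((n : ℝ) + 1) ^ 2 * ((pq.eval n : ℕ) : ℝ) := by linarith

/-- **Peikert's admissible factor is met.** Eventually (`d ≥ 3`, `α(n) > 0`)
`2d/(α₁√(log d)) ≤ gapFactorSeq α n = max(1, 4d/α₁)`: the factor threshold of `h₁` (twice the
`n/(α√(log n))` of Peikert 2009, Thm. 3.1, at dimension `d` and rate `α₁`).
[cite: Peikert2009, Thm. 3.1; BrakerskiEtAl2013, Thm. 2.16] -/
theorem eventually_threshold_le_gapFactorSeq (hα : ∀ᶠ n : ℕ in atTop, 0 < α n) :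
    ∀ᶠ n : ℕ in atTop,
      2 * (dim n : ℝ) / (rate₁ α n * Real.sqrt (Real.log (dim n))) ≤ gapFactorSeq α n := by
  filter_upwards [eventually_rate₁_pos hα, eventually_ge_atTop 9] with n hr h9
  have hd3 : 3 ≤ dim n := by
    rw [dim, Nat.le_sqrt]
    omega
  have hd3' : (3 : ℝ) ≤ dim n := by exact_mod_cast hd3
  have hlog : 1 ≤ Real.sqrt (Real.log (dim n)) := by
    rw [show (1 : ℝ) = Real.sqrt 1 by simp]
    refine Real.sqrt_le_sqrt ?_
    rw [Real.le_log_iff_exp_le (by linarith)]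
    have := Real.exp_one_lt_d9
    linarith
  refine le_trans ?_ (le_max_right _ _)
  have hd0 : (0 : ℝ) ≤ 2 * (dim n : ℝ) := by positivity
  calc 2 * (dim n : ℝ) / (rate₁ α n * Real.sqrt (Real.log (dim n)))
        ≤ 2 * (dim n : ℝ) / rate₁ α n := by
          refine div_le_div_of_nonneg_left hd0 hr ?_
          nlinarith
    _ ≤ 4 * (dim n : ℝ) / rate₁ α n := by
          rw [div_le_div_iff_of_pos_right hr]
          linarith

/-! ### The printed side conditions of the components, for the fixed formulas -/

/-- `Q` is a power of two and `log₂ Q = ⌊d/2⌋ + 2`. [cite: BrakerskiEtAl2013, Thm. 2.17 (`q` a power of `2`)] -/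
theorem log_two_modulus (n : ℕ) : Nat.log 2 (modulus n) = dim n / 2 + 2 :=
  Nat.log_pow Nat.one_lt_two _

/-- **Thm. 2.16's `q ≥ 2^{n/2}`** at dimension `d`: `2^{d/2} ≤ Q` (real exponent `d/2`).
[cite: BrakerskiEtAl2013, Thm. 2.16] -/
theorem two_rpow_half_dim_le_modulus (n : ℕ) : (2 : ℝ) ^ ((dim n : ℝ) / 2) ≤ modulus n := by
  have h : ((dim n : ℝ) / 2) ≤ ((dim n / 2 + 2 : ℕ) : ℝ) := by
    have h1 : (dim n : ℝ) ≤ 2 * ((dim n / 2 : ℕ) : ℝ) + 2 := by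
      have : dim n ≤ 2 * (dim n / 2) + 2 := by omega
      exact_mod_cast this
    push_cast
    linarith
  calc (2 : ℝ) ^ ((dim n : ℝ) / 2) ≤ (2 : ℝ) ^ (((dim n / 2 + 2 : ℕ) : ℝ)) :=
        Real.rpow_le_rpow_of_exponent_le one_le_two h
    _ = modulus n := by rw [Real.rpow_natCast, modulus]; push_cast; ring

/-- **Thm. 4.1's dimension condition** `n ≥ (k+1) log₂ q + 2 log₂(1/δ)` at `k = d`, `q = Q`
(`log₂ Q = ⌊d/2⌋+2`) and `δ = 2^{-⌊n/8⌋}` (a negligible advantage loss): eventually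
`(d+1)(⌊d/2⌋+2) + 2⌊n/8⌋ ≤ n`. [cite: BrakerskiEtAl2013, Thm. 4.1] -/
theorem eventually_dim_condition :
    ∀ᶠ n : ℕ in atTop, (dim n + 1) * Nat.log 2 (modulus n) + 2 * (n / 8) ≤ n := by
  filter_upwards [eventually_ge_atTop 121] with n hn
  rw [log_two_modulus]
  have hd : 11 ≤ dim n := by
    rw [dim, Nat.le_sqrt]
    omega
  have hdn : dim n * dim n ≤ n := Nat.sqrt_le n
  -- pass to `ℝ` for the nonlinear arithmetic
  have hd' : (11 : ℝ) ≤ dim n := by exact_mod_cast hd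
  have hdn' : (dim n : ℝ) * dim n ≤ n := by exact_mod_cast hdn
  have h1 : (((dim n + 1) * (dim n / 2 + 2) + 2 * (n / 8) : ℕ) : ℝ) ≤
      ((dim n : ℝ) + 1) * ((dim n : ℝ) / 2 + 2) + (n : ℝ) / 4 := by
    have ha : ((dim n / 2 : ℕ) : ℝ) ≤ (dim n : ℝ) / 2 := Nat.cast_div_le
    have hb : ((n / 8 : ℕ) : ℝ) ≤ (n : ℝ) / 8 := Nat.cast_div_le
    push_cast
    nlinarith
  have h2 : ((dim n : ℝ) + 1) * ((dim n : ℝ) / 2 + 2) + (n : ℝ) / 4 ≤ n := by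
    nlinarith [mul_nonneg (sub_nonneg.2 hd') (by positivity : (0 : ℝ) ≤ (dim n : ℝ) + 1)]
  exact_mod_cast h1.trans h2

/-- `α₂ = α₁ · (⌊log₂ n⌋+1)²` (**Thm. 2.17's `α' = α · ω(log n)`**: `(⌊log₂ n⌋+1)²/log d → ∞`).
[cite: BrakerskiEtAl2013, Thm. 2.17] -/
theorem rate₂_eq_rate₁_mul (α : ℕ → ℝ) (n : ℕ) :
    rate₂ α n = rate₁ α n * ((Nat.log 2 n + 1 : ℕ) : ℝ) ^ 2 := by
  have h : ((Nat.log 2 n + 1 : ℕ) : ℝ) ^ 2 ≠ 0 := by positivity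
  rw [rate₁, div_mul_cancel₀ _ h]

/-- **Cor. 3.2's noise budget.** Eventually `20 n α₂² ≤ α²`, i.e. `10 n α₂² ≤ α²/2`: with
`β² = 10nα₂² + (4n/(πq²)) ln(2n(1+1/ξ))` this leaves `(4n/(πq²)) ln(2n(1+1/ξ)) ≤ α²/2` for the
modulus-switching term (`eventually_modSwitch_budget`), so that `β ≤ α`. [cite: BrakerskiEtAl2013, Cor. 3.2 and p. 13] -/
theorem eventually_noise_budget (α : ℕ → ℝ) :
    ∀ᶠ n : ℕ in atTop, 20 * n * rate₂ α n ^ 2 ≤ α n ^ 2 := by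
  filter_upwards [eventually_ge_atTop 4] with n hn
  have hd : 2 ≤ dim n := by
    rw [dim, Nat.le_sqrt]
    omega
  have hd' : (2 : ℝ) ≤ dim n := by exact_mod_cast hd
  have hlt : (n : ℝ) < ((dim n : ℝ) + 1) ^ 2 := by
    have := Nat.lt_succ_sqrt' n
    rw [dim]
    exact_mod_cast this
  have hdpos : (0 : ℝ) < 8 * dim n := by positivity
  rw [rate₂, div_pow, mul_div_assoc']
  rw [div_le_iff₀ (by positivity)]
  -- `20 n ≤ 64 d²` since `n < (d+1)² ≤ 3.2 d²` for `d ≥ 2`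
  have h64 : 20 * (n : ℝ) ≤ (8 * (dim n : ℝ)) ^ 2 := by nlinarith
  have hα2 : 0 ≤ α n ^ 2 := sq_nonneg _
  nlinarith

/-- **The modulus-switching term fits.** For every `c` (quality `ξ = n^{-c}`), eventually
`(8n/π) ln(2n(1+n^c)) ≤ (αq)²`, i.e. `(4n/(πq²)) ln(2n(1+1/ξ)) ≤ α²/2`, from `αq ≥ √n log n`
(`(8/π) ln(2n(1+n^c)) = O(log n) = o((log n)²)`). [cite: BrakerskiEtAl2013, Cor. 3.2 and p. 13] -/
theorem eventually_modSwitch_budget (c : ℕ)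
    (hα : ∀ᶠ n : ℕ in atTop, 0 < α n ∧ α n < 1 ∧ Real.sqrt n * Real.log n ≤ α n * q n) :
    ∀ᶠ n : ℕ in atTop, 8 * n / Real.pi * Real.log (2 * n * (1 + (n : ℝ) ^ c)) ≤ (α n * q n) ^ 2 := by
  have hlog : ∀ᶠ n : ℕ in atTop, (8 / Real.pi) * (c + 3) ≤ Real.log n :=
    (Real.tendsto_log_atTop.comp tendsto_natCast_atTop_atTop).eventually_ge_atTop _
  filter_upwards [hα, hlog, eventually_ge_atTop 4] with n hn hlogn h4
  have hn4 : (4 : ℝ) ≤ n := by exact_mod_cast h4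
  have hn0 : (0 : ℝ) < n := by linarith
  have hlog0 : 0 < Real.log n := Real.log_pos (by linarith)
  -- `ln(2n(1+n^c)) ≤ ln(n^{c+3})` for `n ≥ 4`
  have hin : 2 * (n : ℝ) * (1 + (n : ℝ) ^ c) ≤ (n : ℝ) ^ (c + 3) := by
    have h1 : 1 + (n : ℝ) ^ c ≤ 2 * (n : ℝ) ^ c := by
      have : 1 ≤ (n : ℝ) ^ c := one_le_pow₀ (by linarith)
      linarith
    have h2 : 2 * (n : ℝ) * (2 * (n : ℝ) ^ c) = 4 * (n : ℝ) ^ (c + 1) := by ring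
    have h3 : 4 * (n : ℝ) ^ (c + 1) ≤ (n : ℝ) ^ (c + 3) := by
      rw [show (n : ℝ) ^ (c + 3) = (n : ℝ) ^ (c + 1) * (n * n) by ring]
      have h0 : (0 : ℝ) ≤ (n : ℝ) ^ (c + 1) := by positivity
      have h16 : (4 : ℝ) ≤ n * n := by nlinarith
      nlinarith [mul_le_mul_of_nonneg_left h16 h0]
    nlinarith [mul_le_mul_of_nonneg_left h1 (by positivity : (0 : ℝ) ≤ 2 * n)]
  have hlogle : Real.log (2 * n * (1 + (n : ℝ) ^ c)) ≤ (c + 3) * Real.log n := by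
    calc Real.log (2 * n * (1 + (n : ℝ) ^ c)) ≤ Real.log ((n : ℝ) ^ (c + 3)) :=
          Real.log_le_log (by positivity) hin
      _ = (c + 3) * Real.log n := by rw [Real.log_pow]; push_cast; ring
  have hsq : (Real.sqrt n * Real.log n) ^ 2 ≤ (α n * q n) ^ 2 :=
    pow_le_pow_left₀ (by positivity) hn.2.2 2
  have hsq' : (Real.sqrt n * Real.log n) ^ 2 = n * Real.log n ^ 2 := by
    rw [mul_pow, Real.sq_sqrt hn0.le]
  rw [hsq'] at hsq
  refine le_trans ?_ hsq
  have hpi : 0 < Real.pi := Real.pi_pos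
  calc 8 * n / Real.pi * Real.log (2 * n * (1 + (n : ℝ) ^ c))
        ≤ 8 * n / Real.pi * ((c + 3) * Real.log n) := by
          refine mul_le_mul_of_nonneg_left hlogle (by positivity)
    _ = n * ((8 / Real.pi) * (c + 3) * Real.log n) := by
          field_simp
    _ ≤ n * (Real.log n * Real.log n) := by
          refine mul_le_mul_of_nonneg_left ?_ hn0.le
          exact mul_le_mul_of_nonneg_right hlogn hlog0.le
    _ = n * Real.log n ^ 2 := by ring

/-- `A · e^k ≤ 2^e` eventually, for every `k` and `A` (powers are `o(2^e)`; the same statement as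
`LWE.RegevReduction`'s `eventually_mul_pow_le_two_pow` in `LWERegevAsymptotics.lean`, kept local to
avoid the import). [folklore] -/
private theorem eventually_const_mul_pow_le_two_pow (k : ℕ) (A : ℝ) :
    ∀ᶠ e : ℕ in atTop, A * (e : ℝ) ^ k ≤ 2 ^ e := by
  have h := tendsto_pow_const_div_const_pow_of_one_lt k (one_lt_two : (1 : ℝ) < 2)
  rcases le_or_gt A 0 with hA | hA
  · exact Eventually.of_forall fun e =>
      (mul_nonpos_of_nonpos_of_nonneg hA (by positivity)).trans (by positivity)
  · have h2 : ∀ᶠ e : ℕ in atTop, (e : ℝ) ^ k / 2 ^ e ≤ 1 / A :=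
      h.eventually (ge_mem_nhds (by positivity : (0 : ℝ) < 1 / A))
    filter_upwards [h2] with e he
    rw [div_le_div_iff₀ (by positivity) hA, one_mul] at he
    linarith

/-- `⌊√n⌋/2 → ∞`. [folklore] -/
theorem tendsto_half_dim_atTop : Tendsto (fun n : ℕ => dim n / 2) atTop atTop := by
  refine tendsto_atTop_atTop.2 fun E => ⟨(2 * E) ^ 2, fun n hn => ?_⟩
  have h : 2 * E ≤ dim n := by
    rw [dim, Nat.le_sqrt]
    calc 2 * E * (2 * E) = (2 * E) ^ 2 := by ring
      _ ≤ n := hn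
  omega

/-- **Exponential beats polynomial.** For every polynomial `p` and constant `A`, eventually
`A · p(n) ≤ 2^{⌊d/2⌋}` (`d = ⌊√n⌋`): on the block of `d`, `n < (d+1)²`. [folklore] -/
theorem eventually_mul_eval_le_two_pow_half_dim (p : Polynomial ℕ) (A : ℝ) :
    ∀ᶠ n : ℕ in atTop, A * ((p.eval n : ℕ) : ℝ) ≤ (2 : ℝ) ^ (dim n / 2) := by
  obtain ⟨c, k, hck⟩ := exists_eval_le_mul_pow_add p
  rcases le_or_gt A 0 with hA | hA
  · exact Eventually.of_forall fun n =>
      (mul_nonpos_of_nonpos_of_nonneg hA (by positivity)).trans (by positivity)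
  -- in terms of `e = ⌊d/2⌋`: `n < (d+1)² ≤ (2e+2)² ≤ (4e)²` for `e ≥ 1`
  have h := tendsto_half_dim_atTop.eventually
    ((eventually_const_mul_pow_le_two_pow (2 * k) (A * (2 * c) * (4 : ℝ) ^ (2 * k))).and
      (eventually_ge_atTop 1))
  filter_upwards [h] with n hn
  obtain ⟨hn, he1⟩ := hn
  set e : ℕ := dim n / 2 with he
  have hne : (n : ℝ) ≤ (4 * (e : ℝ)) ^ 2 := by
    have h1 : n < (dim n + 1) ^ 2 := Nat.lt_succ_sqrt' n
    have h2 : dim n + 1 ≤ 4 * e := by omega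
    have h3 : n ≤ (4 * e) ^ 2 := h1.le.trans (Nat.pow_le_pow_left h2 2)
    exact_mod_cast h3
  have hn1 : (1 : ℝ) ≤ n := by
    have : 1 ≤ dim n := by omega
    have : 1 ≤ n := le_trans this (Nat.sqrt_le_self n)
    exact_mod_cast this
  have hpoly : ((p.eval n : ℕ) : ℝ) ≤ 2 * c * (n : ℝ) ^ k := by
    have h1 : ((p.eval n : ℕ) : ℝ) ≤ c * (n : ℝ) ^ k + c := by exact_mod_cast hck n
    have h2 : (c : ℝ) ≤ c * (n : ℝ) ^ k := by
      have : (1 : ℝ) ≤ (n : ℝ) ^ k := one_le_pow₀ hn1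
      have hc : (0 : ℝ) ≤ c := by positivity
      nlinarith
    linarith
  have hnk : (n : ℝ) ^ k ≤ (4 : ℝ) ^ (2 * k) * (e : ℝ) ^ (2 * k) := by
    calc (n : ℝ) ^ k ≤ ((4 * (e : ℝ)) ^ 2) ^ k := pow_le_pow_left₀ (by positivity) hne k
      _ = (4 : ℝ) ^ (2 * k) * (e : ℝ) ^ (2 * k) := by rw [← pow_mul, mul_pow]
  calc A * ((p.eval n : ℕ) : ℝ) ≤ A * (2 * c * (n : ℝ) ^ k) := mul_le_mul_of_nonneg_left hpoly hA.le
    _ ≤ A * (2 * c * ((4 : ℝ) ^ (2 * k) * (e : ℝ) ^ (2 * k))) := by gcongr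
    _ = A * (2 * c) * (4 : ℝ) ^ (2 * k) * (e : ℝ) ^ (2 * k) := by ring
    _ ≤ 2 ^ e := hn

/-- **The rates are admissible.** Under the hypotheses of pqc.S21 with `k = 1`, eventually:
`0 < α₁ < α₂ < α < 1` and `1/Q < α₁` (**Thm. 2.17**: `1/q < α`; and `α < 1/ω(√(log n))` as
`α₁√(log d) ≤ √(log d)/(8d) → 0`), `2√d ≤ α₁ Q` and `α₁ < 1` (**Thm. 2.16**: `αq ≥ 2√n`, `α ∈ (0,1)`).
The two conditions involving `Q = 2^{⌊d/2⌋+2}` are "exponential beats polynomial":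
`1/α₁ = 8d(⌊log₂ n⌋+1)²/α ≤ 8 n (n+1)² q(n)`. [cite: BrakerskiEtAl2013, Thm. 2.16 and Thm. 2.17] -/
theorem eventually_rates (hq : IsPolyBounded q)
    (hα : ∀ᶠ n : ℕ in atTop, 0 < α n ∧ α n < 1 ∧ Real.sqrt n * Real.log n ≤ α n * q n) :
    ∀ᶠ n : ℕ in atTop, 0 < rate₁ α n ∧ rate₁ α n < rate₂ α n ∧ rate₂ α n < α n ∧ α n < 1 ∧
      1 / (modulus n : ℝ) < rate₁ α n ∧ 2 * Real.sqrt (dim n) ≤ rate₁ α n * modulus n := by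
  obtain ⟨pq, hpq⟩ := hq
  have hexp := eventually_mul_eval_le_two_pow_half_dim
    (Polynomial.C 16 * Polynomial.X * (Polynomial.X + 1) ^ 2 * pq) 1
  filter_upwards [eventually_inv_rate_le hα, hexp, eventually_ge_atTop 4] with n hn hexpn h4
  obtain ⟨hα0, hα1, h1αq, hinv⟩ := hn
  have hd : 2 ≤ dim n := by
    rw [dim, Nat.le_sqrt]
    omega
  have hd' : (2 : ℝ) ≤ dim n := by exact_mod_cast hd
  set L : ℝ := ((Nat.log 2 n + 1 : ℕ) : ℝ) with hL
  have hL2 : 2 ≤ L := by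
    rw [hL]
    have : 1 ≤ Nat.log 2 n := Nat.le_log_of_pow_le Nat.one_lt_two (by simpa using le_trans (by norm_num) h4)
    exact_mod_cast Nat.succ_le_succ this
  have hr1 : rate₁ α n = α n / (8 * dim n * L ^ 2) := by rw [rate₁_eq]
  have hr2 : rate₂ α n = α n / (8 * dim n) := rfl
  have hden1 : (0 : ℝ) < 8 * dim n * L ^ 2 := by positivity
  have hden2 : (0 : ℝ) < 8 * dim n := by positivity
  -- shared crude bounds
  have hdn : (dim n : ℝ) ≤ n := by exact_mod_cast Nat.sqrt_le_self n
  have hd2 : (dim n : ℝ) ^ 2 ≤ n := by exact_mod_cast Nat.sqrt_le' n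
  have hLn : L ≤ (n : ℝ) + 1 := by
    rw [hL]
    exact_mod_cast Nat.succ_le_succ (Nat.log_le_self 2 n)
  have hL0 : 0 ≤ L := by linarith
  have hqp : (q n : ℝ) ≤ ((pq.eval n : ℕ) : ℝ) := by exact_mod_cast hpq n
  have hq0 : (0 : ℝ) ≤ q n := by positivity
  have hexpn' : 16 * (n : ℝ) * ((n : ℝ) + 1) ^ 2 * ((pq.eval n : ℕ) : ℝ) ≤ (2 : ℝ) ^ (dim n / 2) := by
    rw [one_mul] at hexpn
    simpa only [Polynomial.eval_mul, Polynomial.eval_C, Polynomial.eval_X, Polynomial.eval_pow,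
      Polynomial.eval_add, Polynomial.eval_one, Nat.cast_mul, Nat.cast_pow, Nat.cast_add,
      Nat.cast_one, Nat.cast_ofNat] using hexpn
  have hQlt : (2 : ℝ) ^ (dim n / 2) < modulus n := by
    rw [modulus]
    push_cast
    exact pow_lt_pow_right₀ one_lt_two (by omega)
  refine ⟨by rw [hr1]; positivity, ?_, ?_, hα1, ?_, ?_⟩
  · -- `α₁ < α₂`: divide by `L² ≥ 4`
    rw [hr1, hr2, div_lt_div_iff_of_pos_left hα0 hden1 hden2]
    have hL4 : 4 ≤ L ^ 2 := by nlinarith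
    nlinarith [mul_le_mul_of_nonneg_left hL4 hden2.le]
  · -- `α₂ < α`
    rw [hr2, div_lt_iff₀ hden2]
    nlinarith
  · -- `1/Q < α₁`, i.e. `8 d L² < α Q`: `8dL² ≤ α (8dL² q) ≤ α 2^{⌊d/2⌋} < α Q`
    have hQpos : (0 : ℝ) < modulus n := lt_trans (by positivity) hQlt
    rw [hr1, div_lt_div_iff₀ hQpos hden1, one_mul]
    have hX : 8 * (dim n : ℝ) * L ^ 2 ≤ α n * (8 * dim n * L ^ 2 * q n) := by
      have h0 : (0 : ℝ) ≤ 8 * dim n * L ^ 2 := hden1.le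
      nlinarith
    have hXq : 8 * (dim n : ℝ) * L ^ 2 * q n ≤ (2 : ℝ) ^ (dim n / 2) := by
      refine le_trans ?_ hexpn'
      have : 8 * (dim n : ℝ) * L ^ 2 ≤ 16 * (n : ℝ) * ((n : ℝ) + 1) ^ 2 := by
        have h1 : 8 * (dim n : ℝ) * L ^ 2 ≤ 8 * (n : ℝ) * ((n : ℝ) + 1) ^ 2 := by gcongr
        nlinarith [sq_nonneg ((n : ℝ) + 1)]
      exact mul_le_mul this hqp hq0 (by positivity)
    calc 8 * (dim n : ℝ) * L ^ 2 ≤ α n * (8 * dim n * L ^ 2 * q n) := hX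
      _ ≤ α n * (2 : ℝ) ^ (dim n / 2) := mul_le_mul_of_nonneg_left hXq hα0.le
      _ < α n * modulus n := mul_lt_mul_of_pos_left hQlt hα0
  · -- `2√d ≤ α₁ Q`, i.e. `2√d · 8dL² ≤ α Q`: `≤ 16 d² L² ≤ α (16 d² L² q) ≤ α 2^{⌊d/2⌋} ≤ α Q`
    rw [hr1, div_mul_eq_mul_div, le_div_iff₀ hden1]
    have hsd : Real.sqrt (dim n) ≤ dim n := by
      calc Real.sqrt (dim n) ≤ Real.sqrt ((dim n : ℝ) ^ 2) := Real.sqrt_le_sqrt (by nlinarith)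
        _ = dim n := Real.sqrt_sq (by positivity)
    have hX : 16 * (dim n : ℝ) ^ 2 * L ^ 2 ≤ α n * (16 * (dim n : ℝ) ^ 2 * L ^ 2 * q n) := by
      have h0 : (0 : ℝ) ≤ 16 * (dim n : ℝ) ^ 2 * L ^ 2 := by positivity
      nlinarith
    have hXq : 16 * (dim n : ℝ) ^ 2 * L ^ 2 * q n ≤ (2 : ℝ) ^ (dim n / 2) := by
      refine le_trans ?_ hexpn'
      have : 16 * (dim n : ℝ) ^ 2 * L ^ 2 ≤ 16 * (n : ℝ) * ((n : ℝ) + 1) ^ 2 := by gcongr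
      exact mul_le_mul this hqp hq0 (by positivity)
    calc 2 * Real.sqrt (dim n) * (8 * dim n * L ^ 2)
          ≤ 2 * (dim n : ℝ) * (8 * dim n * L ^ 2) := by gcongr
      _ = 16 * (dim n : ℝ) ^ 2 * L ^ 2 := by ring
      _ ≤ α n * (16 * (dim n : ℝ) ^ 2 * L ^ 2 * q n) := hX
      _ ≤ α n * (2 : ℝ) ^ (dim n / 2) := mul_le_mul_of_nonneg_left hXq hα0.le
      _ ≤ α n * modulus n := mul_le_mul_of_nonneg_left hQlt.le hα0.le

end Parameters


end BLPRS2013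

open BLPRS2013

/-! ### Assembly: pqc.S21 from the printed components -/

section Assembly

variable (q : ℕ → ℕ) [∀ n, NeZero (q n)] (m : ℕ → ℕ)

/-- **pqc.S21 from the printed components of BLPRS 2013** (the paper's "formal statement of
Theorem 1.1", p. 13). The hypotheses are machine forms of printed results (NOT proved here; a split of
the named fact `blprs_gapSVP_sqrt_dim_to_lwe_classical` would vendor `h₁`–`h₃` as named facts, while
`h₄` IS the tree's pqc.S22 `regev_search_to_decision q`). All of them are quantified over the noise rate
`α` under the hypotheses of pqc.S21 with `k = 1` — `q`, `m` polynomially bounded, `IsPolyTimeParams q α m`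
(the parameters are computable from `1ⁿ`, so are the derived `d, Q, α₁, α₂`, `α` being rational),
`α(n) ∈ (0,1)` and `αq ≥ √n log n` eventually — and use the fixed derived parameters of this file
(`dim`, `modulus`, `rate₁`, `rate₂`; their printed side conditions are the lemmas
`two_pow_le_modulus`, `eventually_dim_condition`, `eventually_rates`, `eventually_noise_budget`):

* `h₁` — **Thm. 2.16, classical clause** (Peikert 2009, Thm. 3.1, for `q ≥ 2^{n/2}`), PRINTED: "Let
  `n, q ≥ 1` be integers and let `α ∈ (0,1)` be such that `αq ≥ 2√n`. Then there exists a quantum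
  reduction from worst-case `n`-dimensional `GapSVP_{Õ(n/α)}` to `LWE_{n,q,α}`. If in addition
  `q ≥ 2^{n/2}` then there is also a classical reduction between those problems." MACHINE FORM, at
  dimension `d = ⌊√n⌋`, modulus `Q = 2^{⌊d/2⌋+2} ≥ 2^{d/2}`, rate `α₁`: for every factor `g(n)`
  eventually `≥ 2d/(α₁√(log d))` (Peikert's admissible `γ ≥ n/(α√(log n))`, doubled for a rational
  parameter choice as in `peikert_gapSVPZeta_to_lwe_classical_of_components`) and every probabilistic
  polynomial-time `R` using `m₁(n)` samples (`m₁` polynomially bounded and polynomial-time computable),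
  a probabilistic polynomial-time `M` such that, for every oracle `O`, if `R^O` solves
  search-`LWE_{d,Q,Ψ̄_{α₁}}` with average-case probability `≥ 2/3` (`SolvesSmallDimSearch`) then `M^O`
  decides `GapSVP` in dimension `d` with factor `g(n)` (`DecidesGapSVPSqrtDim`).
* `h₂` — **Thm. 2.17** (special case of Micciancio–Peikert 2012), PRINTED: "Let `q` be a power of `2`,
  and `α` satisfy `1/q < α < 1/ω(√(log n))`. Then there exists an efficient reduction from search
  `LWE_{n,q,α}` to (decision) `LWE_{n,q,α'}` for `α' = α · ω(log n)`." MACHINE FORM at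
  `(d, Q, α₁, α₂ = α₁(⌊log₂ n⌋+1)²)`: every probabilistic polynomial-time distinguisher with advantage
  `≥ 1/n^c` on `m₂(n)` samples (`DistinguishesSmallDim`; `m₂` polynomially bounded and computable)
  yields a probabilistic polynomial-time solver with `m₁(n)` samples (`SolvesSmallDimSearch`).
* `h₃` — **Thm. 4.1 with Cor. 3.2, Lemma 2.15 and Def. 2.11** (the paper's §3–§4, quoted in the
  module docstring), MACHINE FORM: every probabilistic polynomial-time distinguisher for
  `LWE_{n,q,Ψ̄_α}` with advantage `≥ 1/n^c` on `m₃(n)` samples (`DecisionLWEDistinguishes` of the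
  tree, `m₃` polynomially bounded) yields a probabilistic polynomial-time distinguisher for
  `LWE_{d,Q,Ψ̄_{α₂}}` with advantage `≥ 1/n^{c'}` on `m₂(n)` samples (`DistinguishesSmallDim`).
* `h₄` — **pqc.S22** `regev_search_to_decision q` (Regev 2009, §4; search ⇒ decision).

PROOF: `k = 1`; `h₄` (its `q ≥ 2` is `eventually_two_le`) turns the oracle into a distinguisher for
`LWE_{n,q,Ψ̄_α}`, `h₃` into one for `LWE_{d,Q,Ψ̄_{α₂}}`, `h₂` into a solver for `LWE_{d,Q,Ψ̄_{α₁}}`,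
`h₁` (at `g = gapFactorSeq α`, admissible by `eventually_threshold_le_gapFactorSeq`) into a `GapSVP`
decider in dimension `⌊√n⌋` for the factor `g(n)`; the factor of pqc.S21 is `γ = blockMax g ≥ 1`
(`DecidesGapSVPSqrtDim.blockMax`), polynomially bounded by `eventually_gapFactorSeq_le` and
`isPolyBoundedReal_blockMax`.
[cite: BrakerskiEtAl2013, Thm. 1.1 via Thms. 2.16, 2.17, 4.1, Cor. 3.2, Lemma 2.15 (p. 13)] -/
theorem blprs_gapSVP_sqrt_dim_to_lwe_classical_of_components
    (h₁ : ∀ (α : ℕ → ℝ) (_ : IsPolyBounded q) (_ : IsPolyBounded m) (_ : IsPolyTimeParams q α m)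
      (_ : ∀ᶠ n : ℕ in atTop, 0 < α n ∧ α n < 1 ∧ Real.sqrt n * Real.log n ≤ α n * q n)
      (g : ℕ → ℝ),
      (∀ᶠ n : ℕ in atTop, 2 * (dim n : ℝ) / (rate₁ α n * Real.sqrt (Real.log (dim n))) ≤ g n) →
      ∀ (R : OracleAlg (List Bool)) (coinsR fuelR : Polynomial ℕ) (m₁ : ℕ → ℕ),
        R.IsPolyTime (encodingList Bool) → IsPolyBounded m₁ →
        PolyTimeComputable unaryEncodeNat encodeNat m₁ →
        ∃ (M : OracleAlg Bool) (coins fuel : Polynomial ℕ), M.IsPolyTime encodingBoolBool ∧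
          ∀ O : Oracle, SolvesSmallDimSearch α R O coinsR fuelR m₁ → DecidesGapSVPSqrtDim g M O coins fuel)
    (h₂ : ∀ (α : ℕ → ℝ) (_ : IsPolyBounded q) (_ : IsPolyBounded m) (_ : IsPolyTimeParams q α m)
      (_ : ∀ᶠ n : ℕ in atTop, 0 < α n ∧ α n < 1 ∧ Real.sqrt n * Real.log n ≤ α n * q n)
      (D : OracleAlg Bool) (coinsD fuelD : Polynomial ℕ) (m₂ : ℕ → ℕ) (c : ℕ),
        D.IsPolyTime encodingBoolBool → IsPolyBounded m₂ →
        PolyTimeComputable unaryEncodeNat encodeNat m₂ →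
        ∃ (R : OracleAlg (List Bool)) (coinsR fuelR : Polynomial ℕ) (m₁ : ℕ → ℕ),
          R.IsPolyTime (encodingList Bool) ∧ IsPolyBounded m₁ ∧
          PolyTimeComputable unaryEncodeNat encodeNat m₁ ∧
          ∀ O : Oracle, DistinguishesSmallDim α D O coinsD fuelD m₂ c →
            SolvesSmallDimSearch α R O coinsR fuelR m₁)
    (h₃ : ∀ (α : ℕ → ℝ) (_ : IsPolyBounded q) (_ : IsPolyBounded m) (_ : IsPolyTimeParams q α m)
      (_ : ∀ᶠ n : ℕ in atTop, 0 < α n ∧ α n < 1 ∧ Real.sqrt n * Real.log n ≤ α n * q n)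
      (D₃ : OracleAlg Bool) (coins₃ fuel₃ : Polynomial ℕ) (m₃ : ℕ → ℕ) (c : ℕ),
        D₃.IsPolyTime encodingBoolBool → IsPolyBounded m₃ →
        ∃ (D : OracleAlg Bool) (coinsD fuelD : Polynomial ℕ) (m₂ : ℕ → ℕ) (c' : ℕ),
          D.IsPolyTime encodingBoolBool ∧ IsPolyBounded m₂ ∧
          PolyTimeComputable unaryEncodeNat encodeNat m₂ ∧
          ∀ O : Oracle,
            DecisionLWEDistinguishes q (fun n => discretizedGaussian (q n) (α n)) m₃
              (fun n => oracleLWEDistinguisher D₃ O coins₃ fuel₃ n (q n) (m₃ n))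
              (fun n => 1 / (n : ℝ) ^ c) →
            DistinguishesSmallDim α D O coinsD fuelD m₂ c')
    (h₄ : regev_search_to_decision q) :
    blprs_gapSVP_sqrt_dim_to_lwe_classical q m := by
  intro hq hm
  refine ⟨1, fun α hpar hα => ?_⟩
  have hα' : ∀ᶠ n : ℕ in atTop, 0 < α n ∧ α n < 1 ∧ Real.sqrt n * Real.log n ≤ α n * q n := by
    simpa only [pow_one] using hα
  have hα0 : ∀ᶠ n : ℕ in atTop, 0 < α n := hα'.mono fun n hn => hn.1
  -- pqc.S22: the search oracle yields a distinguisher for `LWE_{n,q,Ψ̄_α}`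
  obtain ⟨D₃, coins₃, fuel₃, m₃, c₃, hD₃, hm₃, H₃⟩ :=
    h₄ α m hq (eventually_two_le hα') hm (hα'.mono fun n hn => ⟨hn.1, hn.2.1⟩)
  -- §3–§4: a distinguisher for `LWE_{d,Q,Ψ̄_{α₂}}`
  obtain ⟨D₂, coins₂, fuel₂, m₂, c₂, hD₂, hm₂, hm₂c, H₂⟩ :=
    h₃ α hq hm hpar hα' D₃ coins₃ fuel₃ m₃ c₃ hD₃ hm₃
  -- Thm. 2.17: a solver for search-`LWE_{d,Q,Ψ̄_{α₁}}`
  obtain ⟨R₁, coins₁, fuel₁, m₁, hR₁, hm₁, hm₁c, H₁⟩ :=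
    h₂ α hq hm hpar hα' D₂ coins₂ fuel₂ m₂ c₂ hD₂ hm₂ hm₂c
  -- Thm. 2.16 (classical): a `GapSVP` decider in dimension `⌊√n⌋` for the factor `g(n)`
  obtain ⟨M, coins, fuel, hM, HM⟩ :=
    h₁ α hq hm hpar hα' (gapFactorSeq α) (eventually_threshold_le_gapFactorSeq hα0)
      R₁ coins₁ fuel₁ m₁ hR₁ hm₁ hm₁c
  obtain ⟨p, hp⟩ := eventually_gapFactorSeq_le hq hα'
  refine ⟨blockMax (gapFactorSeq α), one_le_blockMax _, isPolyBoundedReal_blockMax hp,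
    M, coins, fuel, hM, fun O hO => ?_⟩
  exact (HM O (H₁ O (H₂ O (H₃ O hO)))).blockMax

end Assembly

end Literature.Computability.Cryptography

end
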